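import Literature.AlgebraicGeometry.Motives.ProjectiveSpaceHyperplaneMultiplicity
import HarnessLib

/-!
# The Weil divisor of an irreducible hypersurface `V₊(F) ⊆ ℙᴺ` is its fundamental cycle

Fulton, *Intersection Theory* (2nd ed. 1998), §2.1 / §1.5: for an effective Cartier divisor `D` the
associated Weil divisor is `[D] = Σ_V ord_V(D) [V]` over the codimension-one subvarieties `V`, and
for `D = V₊(F)` on `ℙᴺ` with `F` an irreducible form the only such `V` is `V₊(F)` itself, with
`ord_{V₊(F)}(F/x_lᵉ) = 1`: **`[V₊(F)] = 1 · [η_F]`**, the prime cycle of the generic point of the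
hypersurface (Fulton, Example 1.9.3: hypersurfaces of `ℙⁿ`; Hartshorne II Prop. 2.5 / Ex. 2.14 for
the points of `Proj`). This extends `ProjSpace.cycle_formDivisor_eq_primeCycle` (linear `F`,
`Motives/ProjectiveSpaceHyperplaneMultiplicity`) to irreducible forms of any degree:

* `MvPolynomial.ideal_eq_bot_of_le_span_singleton_of_not_mem` — a prime `𝔮 ⊆ (F)` not containing
  the prime form `F` is zero (descent on the total degree); whence
* `ProjSpace.hypersurfacePoint F` — **the generic point `η_F` of `V₊(F)`**: the point of
  `ℙ^{d+1}_K` with relevant homogeneous prime `(F)` (`toIdeal_hypersurfacePoint`), of codimension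
  one (`coheight_hypersurfacePoint`), with `closure {η_F} = V₊(F)` (`closure_hypersurfacePoint`);
* `ProjSpace.primeIdealOf_eq_span_sec_of_form` — in the chart `D₊(x_l)` the prime of a point whose
  homogeneous prime is `(F)`, `deg F = e ≥ 1`, is generated by the section `F/x_lᵉ`; so
  `ord_{η_F}(F/x_lᵉ) = 1` (`ord_formToFunctionField_eq_one_of_form`);
* `ProjSpace.cycle_formDivisor_eq_primeCycle_of_prime` — **`[V₊(F)] = primeCycle η_F`** for a prime
  form `F`; `ProjSpace.height_hypersurfacePoint` — `dim V₊(F) = d`.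

Everything is proved; the only definition is the point `hypersurfacePoint`.

## References

* W. Fulton, *Intersection Theory*, 2nd ed., Springer (1998): §2.1 (pp. 29–31), §1.5 (p. 15),
  Example 1.9.3 (p. 23). [Fulton1998]
* R. Hartshorne, *Algebraic Geometry*, GTM 52, Springer (1977), II Prop. 2.5. [Hartshorne1977]
-/

noncomputable section

universe u

open CategoryTheory AlgebraicGeometry Order Topology TopologicalSpace IsLocalRing HomogeneousLocalization
open MvPolynomial (X C)
open Literature.AlgebraicGeometry.Motives.Segre Literature.AlgebraicGeometry.Motives.RatFn

attribute [local instance] MvPolynomial.gradedAlgebra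

/-! ### Algebra: primes below a principal prime of `K[x]` -/

namespace MvPolynomial

variable {K : Type u} [Field K] {σ : Type*}

/-- A prime polynomial has positive total degree (constants are units or zero). [folklore] -/
theorem totalDegree_pos_of_prime {F : MvPolynomial σ K} (hF : Prime F) : 0 < F.totalDegree := by
  by_contra h
  have h0 : F.totalDegree = 0 := Nat.eq_zero_of_not_pos h
  rw [totalDegree_eq_zero_iff_eq_C] at h0
  by_cases hc : F.coeff 0 = 0
  · exact hF.ne_zero (by rw [h0, hc, map_zero])
  · exact hF.not_unit (by rw [h0]; exact (isUnit_iff_ne_zero.mpr hc).map C)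

/-- **A prime ideal `𝔮 ⊆ (F)` of `K[x]` not containing the prime polynomial `F` is zero**: if
`0 ≠ G ∈ 𝔮` then `G = F H` with `H ∈ 𝔮` of smaller total degree — descent. (The primes strictly
below the height-one prime `(F)`.) [folklore] -/
theorem ideal_eq_bot_of_le_span_singleton_of_not_mem {F : MvPolynomial σ K} (hF : Prime F)
    {𝔮 : Ideal (MvPolynomial σ K)} [𝔮.IsPrime] (hle : 𝔮 ≤ Ideal.span {F}) (hFq : F ∉ 𝔮) :
    𝔮 = ⊥ := by
  rw [eq_bot_iff]
  suffices h : ∀ n : ℕ, ∀ G ∈ 𝔮, G.totalDegree ≤ n → G = 0 by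
    intro G hG
    exact (Submodule.mem_bot _).2 (h _ G hG le_rfl)
  intro n
  induction n with
  | zero =>
    intro G hG hdeg
    have h0 : G.totalDegree = 0 := Nat.eq_zero_of_le_zero hdeg
    rw [totalDegree_eq_zero_iff_eq_C] at h0
    by_contra hG0
    have hc : G.coeff 0 ≠ 0 := fun hc => hG0 (by rw [h0, hc, map_zero])
    have hunit : IsUnit G := by rw [h0]; exact (isUnit_iff_ne_zero.mpr hc).map C
    exact Ideal.IsPrime.ne_top inferInstance (Ideal.eq_top_of_isUnit_mem _ hG hunit)
  | succ n ih =>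
    intro G hG hdeg
    by_contra hG0
    obtain ⟨H, rfl⟩ := Ideal.mem_span_singleton'.1 (hle hG)
    have hH : H ∈ 𝔮 := ((Ideal.IsPrime.mem_or_mem inferInstance hG).resolve_right hFq)
    have hH0 : H ≠ 0 := fun h => hG0 (by rw [h, zero_mul])
    have hdegH : H.totalDegree ≤ n := by
      have hmul := totalDegree_mul_of_isDomain hH0 hF.ne_zero
      have hpos := totalDegree_pos_of_prime hF
      omega
    exact hH0 (ih H hH hdegH)

end MvPolynomial

namespace Literature.AlgebraicGeometry.Motives

namespace ProjSpace

variable {d : ℕ} {K : Type u} [Field K]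

/-! ### The generic point of a hypersurface -/

/-- A form of degree `e` which is prime has `e ≥ 1`. [folklore] -/
theorem pos_of_mem_grading_of_prime {e : ℕ} {F : MvPolynomial (Fin (d + 1)) K}
    (hF : F ∈ grading (Fin (d + 1)) K e) (hprime : Prime F) : 0 < e := by
  have hdeg := ((MvPolynomial.mem_homogeneousSubmodule e F).1 hF).totalDegree hprime.ne_zero
  have hpos := MvPolynomial.totalDegree_pos_of_prime hprime
  omega

/-- **The generic point `η_F` of the hypersurface `V₊(F) ⊆ ℙ^{d+1}_K`** of a prime form `F`: the
point of `Proj K[x₀, …, x_{d+1}]` whose relevant homogeneous prime is `(F)` (Hartshorne II Prop. 2.5;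
`(F)` is relevant since it cannot contain both `x₀` and `x₁`). [cite: Hartshorne1977, II Prop. 2.5] -/
def hypersurfacePoint {e : ℕ} (F : MvPolynomial (Fin (d + 1 + 1)) K)
    (hF : F ∈ grading (Fin (d + 1 + 1)) K e) (hprime : Prime F) : ↥(projectiveSpace (d + 1) K).left :=
  (⟨⟨Ideal.span {F}, Ideal.homogeneous_span _ _ fun x hx => ⟨e, by
      rw [Set.mem_singleton_iff.mp hx]; exact hF⟩⟩,
    (Ideal.span_singleton_prime hprime.ne_zero).mpr hprime, fun h => by
      have hXmem : ∀ j : Fin (d + 1 + 1), F ∣ (X j : MvPolynomial (Fin (d + 1 + 1)) K) := fun j => by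
        have hj : (X j : MvPolynomial (Fin (d + 1 + 1)) K) ∈
            HomogeneousIdeal.irrelevant (MvPolynomial.homogeneousSubmodule (Fin (d + 1 + 1)) K) :=
          HomogeneousIdeal.mem_irrelevant_of_mem _ zero_lt_one (X_mem_homogeneousSubmodule_one j)
        exact Ideal.mem_span_singleton.mp (h hj)
      have hirr : Irreducible F := hprime.irreducible
      have h0 : Associated F (X 0) :=
        (hirr.dvd_irreducible_iff_associated
          (MvPolynomial.X_prime (i := (0 : Fin (d + 1 + 1))) (R := K)).irreducible).1 (hXmem 0)
      have h1 : Associated F (X 1) :=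
        (hirr.dvd_irreducible_iff_associated
          (MvPolynomial.X_prime (i := (1 : Fin (d + 1 + 1))) (R := K)).irreducible).1 (hXmem 1)
      have h01 : (X 0 : MvPolynomial (Fin (d + 1 + 1)) K) ∣ X 1 := (h0.symm.trans h1).dvd
      rw [MvPolynomial.X_dvd_X] at h01
      exact absurd (congrArg Fin.val h01) (by simp)⟩ :
    ProjectiveSpectrum (MvPolynomial.homogeneousSubmodule (Fin (d + 1 + 1)) K))

/-- The homogeneous prime of `η_F` is `(F)` (`rfl`). [folklore] -/
theorem toIdeal_hypersurfacePoint {e : ℕ} (F : MvPolynomial (Fin (d + 1 + 1)) K)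
    (hF : F ∈ grading (Fin (d + 1 + 1)) K e) (hprime : Prime F) :
    ((hypersurfacePoint F hF hprime).asHomogeneousIdeal).toIdeal = Ideal.span {F} :=
  rfl

/-- `closure {η_F} = V₊(F)`. [cite: Hartshorne1977, II Prop. 2.5] -/
theorem closure_hypersurfacePoint {e : ℕ} (F : MvPolynomial (Fin (d + 1 + 1)) K)
    (hF : F ∈ grading (Fin (d + 1 + 1)) K e) (hprime : Prime F) :
    closure {hypersurfacePoint F hF hprime} =
      ProjectiveSpectrum.zeroLocus (MvPolynomial.homogeneousSubmodule (Fin (d + 1 + 1)) K) {F} := by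
  rw [closure_singleton_eq_zeroLocus (N := d + 1) (k := K)]
  change ProjectiveSpectrum.zeroLocus _ (((hypersurfacePoint F hF hprime).asHomogeneousIdeal).toIdeal :
    Set (MvPolynomial (Fin (d + 1 + 1)) K)) = _
  rw [toIdeal_hypersurfacePoint, ProjectiveSpectrum.zeroLocus_span]

/-- **`codim V₊(F) = 1`**: the only point strictly generising `η_F` is the generic point of
`ℙ^{d+1}` (a prime strictly below `(F)` is zero,
`MvPolynomial.ideal_eq_bot_of_le_span_singleton_of_not_mem`). [cite: Hartshorne1977, II Prop. 2.5] -/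
theorem coheight_hypersurfacePoint {e : ℕ} (F : MvPolynomial (Fin (d + 1 + 1)) K)
    (hF : F ∈ grading (Fin (d + 1 + 1)) K e) (hprime : Prime F) :
    coheight (hypersurfacePoint F hF hprime) = 1 := by
  set η := hypersurfacePoint F hF hprime with hη
  -- every strict generisation of `η` is the generic point `⊤`
  have hgen : ∀ y : ↥(projectiveSpace (d + 1) K).left, η < y → y = ⊤ := by
    intro y hy
    have hle' : (y.asHomogeneousIdeal).toIdeal ≤ (η.asHomogeneousIdeal).toIdeal :=
      specializes_iff_le.1 (Scheme.le_iff_specializes.mp hy.le)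
    have hne : (y.asHomogeneousIdeal).toIdeal ≠ (η.asHomogeneousIdeal).toIdeal := by
      intro h
      apply hy.ne
      exact (ProjectiveSpectrum.ext (HomogeneousIdeal.toIdeal_injective h)).symm
    have hFy : F ∉ y.asHomogeneousIdeal := by
      intro hFy
      apply hne (le_antisymm hle' ?_)
      rw [hη, toIdeal_hypersurfacePoint, Ideal.span_singleton_le_iff_mem]
      exact hFy
    haveI : (y.asHomogeneousIdeal).toIdeal.IsPrime := y.isPrime
    have hbot : (y.asHomogeneousIdeal).toIdeal = ⊥ :=
      MvPolynomial.ideal_eq_bot_of_le_span_singleton_of_not_mem hprime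
        (hle'.trans_eq (by rw [hη]; exact toIdeal_hypersurfacePoint F hF hprime)) hFy
    -- `𝔭_y = 0`: `y` is the generic point
    have hcl : closure ({y} : Set ↥(projectiveSpace (d + 1) K).left) = Set.univ := by
      rw [closure_singleton_eq_zeroLocus (N := d + 1) (k := K)]
      change ProjectiveSpectrum.zeroLocus _ ((y.asHomogeneousIdeal).toIdeal :
        Set (MvPolynomial (Fin (d + 1 + 1)) K)) = _
      rw [hbot]
      exact ProjectiveSpectrum.zeroLocus_bot _
    have hgy : IsGenericPoint y (⊤ : Set ↥(projectiveSpace (d + 1) K).left) := by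
      rw [isGenericPoint_def, hcl]; rfl
    exact hgy.eq (genericPoint_spec ↥(projectiveSpace (d + 1) K).left)
  -- the point with zero ideal strictly generises `η`, hence `η < ⊤`
  let y₀ : ↥(projectiveSpace (d + 1) K).left :=
    (⟨⊥, by rw [HomogeneousIdeal.toIdeal_bot]; exact Ideal.isPrime_bot, fun h => by
      have hX : (X 0 : MvPolynomial (Fin (d + 1 + 1)) K) ∈
          HomogeneousIdeal.irrelevant (MvPolynomial.homogeneousSubmodule (Fin (d + 1 + 1)) K) :=
        HomogeneousIdeal.mem_irrelevant_of_mem _ zero_lt_one (X_mem_homogeneousSubmodule_one 0)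
      have h0 := h hX
      rw [← HomogeneousIdeal.mem_iff, HomogeneousIdeal.toIdeal_bot, Ideal.mem_bot] at h0
      exact MvPolynomial.X_ne_zero _ h0⟩ :
      ProjectiveSpectrum (MvPolynomial.homogeneousSubmodule (Fin (d + 1 + 1)) K))
  have hy₀ : η < y₀ := by
    refine lt_of_le_not_ge (Scheme.le_iff_specializes.mpr (specializes_iff_le.2 ?_)) fun hge => ?_
    · change ((⊥ : HomogeneousIdeal _).toIdeal) ≤ _
      rw [HomogeneousIdeal.toIdeal_bot]
      exact bot_le
    · have hF1 : F ∈ (η.asHomogeneousIdeal).toIdeal := by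
        rw [hη, toIdeal_hypersurfacePoint]; exact Ideal.mem_span_singleton_self F
      have hle0 : (η.asHomogeneousIdeal).toIdeal ≤ (y₀.asHomogeneousIdeal).toIdeal :=
        specializes_iff_le.1 (Scheme.le_iff_specializes.mp hge)
      have hF0 := hle0 hF1
      change F ∈ (⊥ : HomogeneousIdeal _).toIdeal at hF0
      rw [HomogeneousIdeal.toIdeal_bot, Ideal.mem_bot] at hF0
      exact hprime.ne_zero hF0
  have hlt : η < ⊤ := by
    rw [← hgen y₀ hy₀]
    exact hy₀
  rw [show (1 : ℕ∞) = ((1 : ℕ) : ℕ∞) from Nat.cast_one.symm, coheight_eq_coe_iff]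
  refine ⟨?_, Or.inr ⟨⊤, hlt, by rw [coheight_top]; rfl⟩, fun y hy => ?_⟩
  · refine lt_of_le_of_lt (coheight_le_coe_iff.2 fun y hy => ?_) (WithTop.coe_lt_top 1)
    rw [hgen y hy, coheight_top, Nat.cast_one]; exact zero_lt_one
  · rw [hgen y hy, coheight_top, Nat.cast_one]; exact zero_lt_one


/-! ### The prime of `η_F` in a chart; `ord_{V₊(F)}(F/x_lᵉ) = 1` -/

/-- **The prime of a hypersurface point in a standard chart is generated by its dehomogenised
equation**: if the homogeneous prime of `y ∈ D₊(x_l)` is `(F)`, `F` a form of degree `e ≥ 1`, then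
`primeIdealOf y ⊆ Γ(D₊(x_l), 𝒪) = (K[x]_{(x_l)})₀` is generated by the section `F/x_lᵉ` (the
degree-`m` members of `(F)` are `H F` with `H` a form of degree `m - e`).
[cite: Hartshorne1977, II Prop. 2.5] -/
theorem primeIdealOf_eq_span_sec_of_form (l : Fin (d + 1)) {y : P d K} (hy : y ∈ U l) {e : ℕ}
    (he : 0 < e) {F : MvPolynomial (Fin (d + 1)) K} (hF : F ∈ grading (Fin (d + 1)) K e)
    (hyF : (y.asHomogeneousIdeal).toIdeal = Ideal.span {F}) :
    ((isAffineOpen_U l).primeIdealOf ⟨y, hy⟩).asIdeal =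
      Ideal.span {sec l (Away.mk _ (X_mem K l) e F (mem_smul_one hF))} := by
  apply le_antisymm
  · intro s hs
    obtain ⟨b, rfl⟩ := (sec_bijective l).2 s
    obtain ⟨m, G, hG, rfl⟩ := Away.mk_surjective (grading (Fin (d + 1)) K) (X_mem K l) b
    have hG' : G ∈ grading (Fin (d + 1)) K m := by simpa using hG
    have hpad : Away.mk _ (X_mem K l) (m + 1) (G * X l ^ 1) (mem_smul_one (mul_X_pow_mem hG' 1)) =
        Away.mk _ (X_mem K l) m G hG := awayMk_mul_X_pow l hG 1 _
    rw [← hpad] at hs ⊢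
    have hGy : G * X l ^ 1 ∈ y.asHomogeneousIdeal :=
      (sec_mk_mem_primeIdealOf_iff l hy (Nat.succ_pos m) (mul_X_pow_mem hG' 1)).1 hs
    have hGy' : G * X l ^ 1 ∈ Ideal.span {F} := by
      rw [← hyF]
      exact hGy
    obtain ⟨H, hH⟩ := Ideal.mem_span_singleton'.1 hGy'
    have hsame : ((DirectSum.decompose (MvPolynomial.homogeneousSubmodule (Fin (d + 1)) K)
        (G * X l ^ 1) (m + 1) : _) : MvPolynomial (Fin (d + 1)) K) = G * X l ^ 1 :=
      DirectSum.decompose_of_mem_same _ (mul_X_pow_mem hG' 1)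
    by_cases hem : e ≤ m + 1
    · -- `G x_l = H_{m+1-e} F`
      have hdec := DirectSum.coe_decompose_mul_of_right_mem_of_le
        (𝒜 := MvPolynomial.homogeneousSubmodule (Fin (d + 1)) K) (a := H) (n := m + 1) hF hem
      set H' : MvPolynomial (Fin (d + 1)) K :=
        ((DirectSum.decompose (MvPolynomial.homogeneousSubmodule (Fin (d + 1)) K) H (m + 1 - e) : _) :
          MvPolynomial (Fin (d + 1)) K) with hH'def
      have hGeq : G * X l ^ 1 = H' * F := by
        rw [← hsame, ← hH, hdec]
      rw [awayMk_eq_eval₂ K l (m + 1) (G * X l ^ 1) (mem_smul_one (mul_X_pow_mem hG' 1)), hGeq, map_mul]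
      change (secRingHom l) _ ∈ _
      rw [map_mul]
      refine Ideal.mul_mem_left _ _ ?_
      rw [← awayMk_eq_eval₂ K l e F (mem_smul_one hF)]
      exact Ideal.mem_span_singleton_self _
    · -- `deg F > m + 1`: the component vanishes, `G x_l = 0`
      have hdec := DirectSum.coe_decompose_mul_of_right_mem_of_not_le
        (𝒜 := MvPolynomial.homogeneousSubmodule (Fin (d + 1)) K) (a := H) (n := m + 1) hF hem
      have hG0 : G * X l ^ 1 = 0 := by
        rw [← hsame, ← hH, hdec]
      have h0 : Away.mk (grading (Fin (d + 1)) K) (X_mem K l) (m + 1) (G * X l ^ 1)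
          (mem_smul_one (mul_X_pow_mem hG' 1)) = 0 := by
        apply val_injective
        simp only [Away.val_mk, hG0, Localization.mk_zero, HomogeneousLocalization.val_zero]
      rw [h0]
      change (secRingHom l) 0 ∈ _
      rw [map_zero]
      exact zero_mem _
  · rw [Ideal.span_le, Set.singleton_subset_iff]
    refine (sec_mk_mem_primeIdealOf_iff l hy he hF).2 ?_
    change F ∈ (y.asHomogeneousIdeal).toIdeal
    rw [hyF]
    exact Ideal.mem_span_singleton_self F

/-- **`ord_{V₊(F)}(F/x_lᵉ) = 1`** at a codimension-one point `η` with homogeneous prime `(F)`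
(`F` a form of degree `e ≥ 1`) lying in `D₊(x_l)`: the local equation generates the maximal ideal of
the discrete valuation ring `𝒪_{ℙ^d, η}` (Fulton, §1.2: `ord_V(r) = ℓ_A(A/(r))`).
[cite: Fulton1998, §1.2 (p. 8) and §2.1] -/
theorem ord_formToFunctionField_eq_one_of_form {e : ℕ} (he : 0 < e)
    {F : MvPolynomial (Fin (d + 1)) K} (hF : F ∈ grading (Fin (d + 1)) K e) (hF0 : F ≠ 0)
    {η : P d K} (hη : (η.asHomogeneousIdeal).toIdeal = Ideal.span {F}) (hcoh : coheight η = 1)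
    {l : Fin (d + 1)} (hl : η ∈ U l) :
    Scheme.ord (formToFunctionField l F) η = 1 := by
  set a : Away (grading (Fin (d + 1)) K) (X l) := Away.mk _ (X_mem K l) e F (mem_smul_one hF) with ha
  set r := ((P d K).presheaf.germ (U l) η hl).hom (sec l a) with hr
  -- `𝔪_η = (r)`
  have hmax : maximalIdeal ((P d K).presheaf.stalk η) = Ideal.span {r} := by
    letI := TopCat.Presheaf.algebra_section_stalk (P d K).presheaf (⟨η, hl⟩ : U (d := d) (K := K) l)
    haveI := (isAffineOpen_U l).isLocalization_stalk ⟨η, hl⟩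
    have h := IsLocalization.AtPrime.map_eq_maximalIdeal
      ((isAffineOpen_U l).primeIdealOf ⟨η, hl⟩).asIdeal ((P d K).presheaf.stalk η)
    rw [primeIdealOf_eq_span_sec_of_form l hl he hF hη, Ideal.map_span, Set.image_singleton] at h
    exact h.symm
  have hfr : toFunctionField η r = formToFunctionField l F := by
    rw [hr, toFunctionField_germ_sec, formToFunctionField_of_mem l (mem_smul_one hF)]
  have hr0 : r ≠ 0 := by
    intro h0
    apply formToFunctionField_ne_zero l hF hF0
    rw [← hfr, h0, map_zero]
  haveI : Ring.KrullDimLE 1 ((P d K).presheaf.stalk η) := krullDimLE_of_coheight_le hcoh.le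
  have hord1 : Ring.ord ((P d K).presheaf.stalk η) r = 1 := by
    rw [Ring.ord, ← hmax]
    haveI : IsSimpleModule ((P d K).presheaf.stalk η)
        (((P d K).presheaf.stalk η) ⧸ maximalIdeal ((P d K).presheaf.stalk η)) :=
      isSimpleModule_iff_quot_maximal.mpr ⟨_, maximalIdeal.isMaximal _, ⟨LinearEquiv.refl _ _⟩⟩
    exact Module.length_eq_one _ _
  rw [← hfr, Scheme.ord_toFunctionField_eq_toNat hcoh hr0, hord1]
  rfl

/-- `ord_η V₊(F) = 1` for the divisor `formDivisor F` at such a point. [cite: Fulton1998, §2.1] -/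
theorem ordAt_formDivisor_eq_one_of_form {e : ℕ} (he : 0 < e)
    {F : MvPolynomial (Fin (d + 1)) K} (hF : F ∈ grading (Fin (d + 1)) K e) (hF0 : F ≠ 0)
    {η : P d K} (hη : (η.asHomogeneousIdeal).toIdeal = Ideal.span {F}) (hcoh : coheight η = 1) :
    (formDivisor F hF hF0).ordAt η = 1 := by
  obtain ⟨i, hi⟩ := (hyperplane d K).covers η
  rw [hyperplane_U] at hi
  have hi' : η ∈ (formDivisor F hF hF0).U (i, PUnit.unit) := (mem_formDivisor_U_iff hF hF0 _).2 hi
  rw [(formDivisor F hF hF0).ordAt_eq_ord hi', formDivisor_f]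
  exact ord_formToFunctionField_eq_one_of_form he hF hF0 hη hcoh hi

/-- **`[V₊(F)] = 1 · [η]`** for a form `F` of degree `e ≥ 1` and a codimension-one point `η` with
homogeneous prime `(F)`: the Weil divisor of `V₊(F)` is the prime cycle of `η` (as in
`cycle_formDivisor_eq_primeCycle`, the linear case). [cite: Fulton1998, §2.1 (pp. 29–31)] -/
theorem cycle_formDivisor_eq_primeCycle_of_form {e : ℕ} (he : 0 < e)
    {F : MvPolynomial (Fin (d + 1)) K} (hF : F ∈ grading (Fin (d + 1)) K e) (hF0 : F ≠ 0)
    {η : P d K} (hη : (η.asHomogeneousIdeal).toIdeal = Ideal.span {F}) (hcoh : coheight η = 1) :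
    (formDivisor F hF hF0).cycle = primeCycle η := by
  ext y
  rw [CartierDivisor.cycle_apply]
  by_cases hyη : y = η
  · subst hyη
    rw [primeCycle_apply_self]
    exact ordAt_formDivisor_eq_one_of_form he hF hF0 hη hcoh
  rw [primeCycle_apply_of_ne hyη]
  by_cases hy1 : coheight y = 1
  · by_cases hFy : F ∈ y.asHomogeneousIdeal
    · exfalso
      have hηy : η ⤳ y := by
        rw [specializes_iff_le, hη, Ideal.span_singleton_le_iff_mem]
        exact hFy
      have hle : y ≤ η := Scheme.le_iff_specializes.mpr hηy
      have hlt : y < η := lt_of_le_not_ge hle fun hge =>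
        hyη (hηy.antisymm (Scheme.le_iff_specializes.mp hge)).eq.symm
      have h1 := height_add_one_le hlt
      have hsy := Scheme.height_add_coheight_eq_height_top ((P d K) ↘ Spec (.of K)) y
      have hsη := Scheme.height_add_coheight_eq_height_top ((P d K) ↘ Spec (.of K)) η
      rw [hy1] at hsy
      rw [hcoh] at hsη
      obtain ⟨a, ha⟩ := ENat.ne_top_iff_exists.mp
        (height_ne_top_of_locallyOfFiniteType ((P d K) ↘ Spec (.of K)) η)
      rw [← ha] at h1 hsη
      rw [← hsη] at hsy
      have heq : height y = (a : ℕ∞) := WithTop.add_right_cancel WithTop.one_ne_top hsy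
      rw [heq] at h1
      exact absurd h1 (by norm_cast; omega)
    · exact CartierDivisor.Avoids.ordAt_eq_zero ((formDivisor_avoids_iff hF hF0 he).2 hFy)
  · obtain ⟨j, hj⟩ := (formDivisor F hF hF0).covers y
    rw [(formDivisor F hF hF0).ordAt_eq_ord hj]
    exact Scheme.ord_eq_zero_of_coheight_neq_one hy1 _

/-- **The Weil divisor of an irreducible hypersurface is its fundamental cycle**:
`[V₊(F)] = primeCycle η_F` for a prime form `F` on `ℙ^{d+1}_K` (Fulton §2.1 / §1.5, with
`ord_{V₊(F)} = 1`). [cite: Fulton1998, §2.1 (pp. 29–31) and §1.5 (p. 15)] -/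
theorem cycle_formDivisor_eq_primeCycle_of_prime {e : ℕ} {F : MvPolynomial (Fin (d + 1 + 1)) K}
    (hF : F ∈ grading (Fin (d + 1 + 1)) K e) (hprime : Prime F) :
    (formDivisor F hF hprime.ne_zero).cycle = primeCycle (hypersurfacePoint F hF hprime) :=
  cycle_formDivisor_eq_primeCycle_of_form (pos_of_mem_grading_of_prime hF hprime) hF hprime.ne_zero
    (toIdeal_hypersurfacePoint F hF hprime) (coheight_hypersurfacePoint F hF hprime)

/-- **`dim V₊(F) = d`** in `ℙ^{d+1}`: the generic point of an irreducible hypersurface has height `d`.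
[cite: Hartshorne1977, II Prop. 2.5] -/
theorem height_hypersurfacePoint {e : ℕ} (F : MvPolynomial (Fin (d + 1 + 1)) K)
    (hF : F ∈ grading (Fin (d + 1 + 1)) K e) (hprime : Prime F) :
    height (hypersurfacePoint F hF hprime) = d := by
  have hsum := Scheme.height_add_coheight_eq_height_top (projectiveSpace (d + 1) K).hom
    (hypersurfacePoint F hF hprime)
  rw [coheight_hypersurfacePoint] at hsum
  haveI := (isSmoothProjective_projectiveSpace_holds K (d + 1)).smoothOfRelativeDimension
  have htop := height_add_coheight_eq_of_smoothOfRelativeDimension (projectiveSpace (d + 1) K).hom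
    (d + 1) (⊤ : ↥(projectiveSpace (d + 1) K).left)
  rw [coheight_top, add_zero] at htop
  have htop' : height (⊤ : ↥(projectiveSpace (d + 1) K).left) = (d : ℕ∞) + 1 := by exact_mod_cast htop
  rw [htop'] at hsum
  exact WithTop.add_right_cancel WithTop.one_ne_top hsum

end ProjSpace

end Literature.AlgebraicGeometry.Motives

end
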